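import Summits.ResolutionOfSingularities.ResolutionOfSingularities.Theorems.ValuativeLuAlphaPTorsorAdaptedDefs
import Summits.ResolutionOfSingularities.ResolutionOfSingularities.Theorems.ValuativeLuAlphaPTorsorAPDict
import Summits.ResolutionOfSingularities.ResolutionOfSingularities.Theorems.ValuativeLuAlphaPTorsorAPLift
import Summits.ResolutionOfSingularities.ResolutionOfSingularities.Theorems.ValuativeLuAlphaPTorsorAPUpB
import Literature.AlgebraicGeometry.Resolution.CompositeValuations
import Literature.AlgebraicGeometry.Resolution.TranscendenceDefect
import HarnessLib

/-!
# S3* level induction, step 2: the final parameter system and its flag-adaptedness (UP-lemma applied)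

Crux `Valuative.LuAlphaPTorsor` (stmt-ResolutionOfSingularities-0641), line `pfaff-line-log-final-forms`,
lead seat c4 — `ap_adaptedPerron` split by the 400-line rule. STEP 2 (`ap_ap_step2`): from the
type-2 transformed ring `R₃ = B[z]` of step 1 (`…APStep1`) assemble the final parameter system
`xf` on `Fin n` (the `z_t` on the top indices, the lifted `u_s` on the lower ones) and its level
map, and prove it FLAG-ADAPTED by the UP-lemma `ap_flagAdaptedChart_of_residual` (`…APUpB`):
`W` is cut out by the `u`-monomials as well, `(R₃, z)` is a `W`-chart, the residual chart is the
re-parametrized one of the induction hypothesis. Also the product identities for exponent vectors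
assembled from top / lower parts. Anchor: `ap_ap_step2_anchor`. [folklore]
-/

set_option linter.dupNamespace false

open IsLocalRing

namespace Summit.ResolutionOfSingularities.ResolutionOfSingularities.Theorems.PfaffLine

open Literature.AlgebraicGeometry.Resolution

/-- Anchor (closed form): the `O`-value of a Laurent monomial. [folklore] -/
theorem ap_ap_step2_anchor : ∀ {K : Type} [Field K] (O : ValuationSubring K) {r : ℕ} (y : Fin r → K) (m : Fin r → ℤ), O.valuation (∏ j, y j ^ (m j)) = ∏ j, O.valuation (y j) ^ (m j) := by
  intro K _ O r y m
  rw [map_prod]; exact Finset.prod_congr rfl fun j _ => map_zpow₀ _ _ _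

set_option maxHeartbeats 800000 in
/-- **STEP 2 of the induction step of S3***: the final system `xf`, its level map, and
flag-adaptedness by the UP-lemma. [folklore] -/
theorem ap_ap_step2 {k K : Type} [Field k] [Field K] [Algebra k K] (O : ValuationSubring K)
    (hk : ∀ c : k, algebraMap k K c ∈ O) {n : ℕ}
    (x : Fin n → K) (lv : Fin n → ℕ) (top : ℕ) (hle : ∀ i, lv i ≤ top) (hx0 : ∀ i, x i ≠ 0)
    (i₀ : Fin n) (hi₀ : lv i₀ = top)
    (W : ValuationSubring K) (hOW : O ≤ W)
    (hWmem : ∀ z : K, z ∈ W ↔ ∃ m : Fin n → ℤ, (∀ j, top ≤ lv j → m j = 0) ∧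
      O.valuation z ≤ ∏ j, O.valuation (x j) ^ (m j))
    (hWr1 : ∀ z w : K, W.valuation z < 1 → w ≠ 0 → ∃ N : ℕ, W.valuation z ^ N < W.valuation w)
    {nT : ℕ} (eT : Fin nT ≃ {i : Fin n // lv i = top}) {nS : ℕ} (eS : Fin nS ≃ {i : Fin n // lv i < top})
    (xT : Fin nT → K) (hind₁ : ∀ m : Fin nT → ℤ, (∏ t, W.valuation (xT t) ^ (m t)) = 1 → m = 0)
    (Rb' : letI := algebraOfMem k W (fun c => hOW (hk c)); Subalgebra k (ResidueField W))
    (hRb'O : letI := algebraOfMem k W (fun c => hOW (hk c)); Rb'.toSubring ≤ (residueValuationSubring O W hOW).toSubring)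
    (xb' : Fin nS → ResidueField W) (hxb' : letI := algebraOfMem k W (fun c => hOW (hk c)); ∀ s, xb' s ∈ Rb') (lvS' : Fin nS → ℕ)
    (hbflag' : letI := algebraOfMem k W (fun c => hOW (hk c));
      FlagAdaptedChart (residueValuationSubring O W hOW) Rb' hRb'O xb' hxb' lvS')
    (u : Fin nS → K) (huW : ∀ s, u s ∈ W) (C' : Fin nS → Fin nS → ℤ)
    (hu : u = fun s => ∏ s1, x (eS s1) ^ (C' s s1)) (hu0 : ∀ s, u s ≠ 0)
    (huπ : ∀ s, residue W ⟨u s, huW s⟩ = xb' s) (huv : ∀ s, O.valuation (u s) < 1)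
    (D' : Fin nS → Fin nS → ℕ) (hxu : ∀ s1, x (eS s1) = ∏ s, u s ^ ((D' s1 s : ℤ)))
    (B : Subalgebra k K) (huB : ∀ s, u s ∈ B) (hBFG : B.FG)
    (z : Fin nT → K) (hzW1 : ∀ t, W.valuation (z t) = W.valuation (xT t)) (hz0 : ∀ t, z t ≠ 0)
    (R₃ : Subalgebra k K) (hR₃O : R₃.toSubring ≤ O.toSubring) (hR₃W : R₃.toSubring ≤ W.toSubring)
    (hzR₃ : ∀ t, z t ∈ R₃) (hBR₃ : B ≤ R₃)
    (hR₃ : R₃ = Algebra.adjoin k ((B : Set K) ∪ Set.range z))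
    (hspan₃ : Ideal.span (Set.range fun t => (⟨z t, hzR₃ t⟩ : R₃.toSubring)) =
      Ideal.comap (Subring.inclusion hR₃W) (maximalIdeal W))
    (hπR₃ : letI := algebraOfMem k W (fun c => hOW (hk c)); ∀ (w : K) (hw : w ∈ R₃), residue W ⟨w, hR₃W hw⟩ ∈ Rb')
    (hsurj₃ : letI := algebraOfMem k W (fun c => hOW (hk c)); ∀ rb ∈ Rb', ∃ (w : K) (hw : w ∈ R₃), residue W ⟨w, hR₃W hw⟩ = rb) :
    ∃ (xf : Fin n → K) (hxfR₃ : ∀ i, xf i ∈ R₃) (lvf : Fin n → ℕ),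
      xf = (fun i => if hi : lv i = top then z (eT.symm ⟨i, hi⟩) else u (eS.symm ⟨i, lt_of_le_of_ne (hle i) hi⟩)) ∧
      (∀ t, xf (eT t) = z t) ∧ (∀ s, xf (eS s) = u s) ∧ (∀ i, xf i ≠ 0) ∧
      FlagAdaptedChart O R₃ hR₃O xf hxfR₃ lvf ∧
      (∀ (bT : Fin nT → ℕ) (bS : Fin nS → ℕ),
        (∏ j, xf j ^ ((fun j => if hj : lv j = top then bT (eT.symm ⟨j, hj⟩) else bS (eS.symm ⟨j, lt_of_le_of_ne (hle j) hj⟩)) j)) =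
          (∏ t, z t ^ (bT t)) * ∏ s, u s ^ (bS s)) ∧
      (∀ (cT : Fin nT → ℤ) (cS : Fin nS → ℤ),
        (∏ j, x j ^ ((fun j => if hj : lv j = top then cT (eT.symm ⟨j, hj⟩) else cS (eS.symm ⟨j, lt_of_le_of_ne (hle j) hj⟩)) j)) =
          (∏ t, x (eT t) ^ (cT t)) * ∏ s, x (eS s) ^ (cS s)) ∧
      (∀ (ms : Fin nS → ℤ),
        (∏ j, O.valuation (xf j) ^ ((fun j => if hj : lv j = top then 0 else ms (eS.symm ⟨j, lt_of_le_of_ne (hle j) hj⟩)) j)) =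
          ∏ s, O.valuation (u s) ^ (ms s)) := by
  classical
  letI := algebraOfMem k W (fun c => hOW (hk c))
  set Ob := residueValuationSubring O W hOW with hOb
  have hsplit := fun (N : Type) [CommMonoid N] (f : Fin n → N) => ap_prod_split lv top eT eS hle f
  have hmonO : ∀ m : Fin nS → ℤ, O.valuation (∏ s, x (eS s) ^ (m s)) = ∏ s, O.valuation (x (eS s)) ^ (m s) :=
    fun m => ap_ap_step2_anchor O (fun s => x (eS s)) m
  -- STEP 4: the final parameter system on `Fin n` and its level map
  set xf : Fin n → K := fun i => if hi : lv i = top then z (eT.symm ⟨i, hi⟩) else u (eS.symm ⟨i, (lt_of_le_of_ne (hle i) hi)⟩) with hxf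
  have hxfT : ∀ t, xf (eT t) = z t := by
    intro t
    have ht : lv ((eT t : {i : Fin n // lv i = top}) : Fin n) = top := (eT t).2
    rw [hxf]; simp only []; rw [dif_pos ht]
    congr 1; apply eT.injective; rw [Equiv.apply_symm_apply]
  have hxfS : ∀ s, xf (eS s) = u s := by
    intro s
    have hs : ¬ lv ((eS s : {i : Fin n // lv i < top}) : Fin n) = top := (eS s).2.ne
    rw [hxf]; simp only []; rw [dif_neg hs]
    congr 1; apply eS.injective; rw [Equiv.apply_symm_apply]
  have hxfR₃ : ∀ i, xf i ∈ R₃ := by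
    intro i; rw [hxf]; simp only []; split_ifs with hi
    · exact hzR₃ _
    · exact hBR₃ (huB _)
  have hxf0 : ∀ i, xf i ≠ 0 := by
    intro i; rw [hxf]; simp only []; split_ifs with hi
    · exact hz0 _
    · exact hu0 _
  set top' : ℕ := Finset.univ.sup lvS' + 1 with htop'
  set lvf : Fin n → ℕ := fun i => if hi : lv i = top then top' else lvS' (eS.symm ⟨i, (lt_of_le_of_ne (hle i) hi)⟩) with hlvf
  have hlvS'lt : ∀ s, lvS' s < top' := fun s => Nat.lt_succ_of_le (Finset.le_sup (Finset.mem_univ s))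
  have hlvfT : ∀ i, lvf i = top' ↔ lv i = top := by
    intro i; rw [hlvf]; simp only []; split_ifs with hi
    · exact ⟨fun _ => hi, fun _ => rfl⟩
    · exact ⟨fun h => absurd h (hlvS'lt _).ne, fun h => absurd h hi⟩
  have hlvfS : ∀ s, lvf (eS s) = lvS' s := by
    intro s
    have hs : ¬ lv ((eS s : {i : Fin n // lv i < top}) : Fin n) = top := (eS s).2.ne
    rw [hlvf]; simp only []; rw [dif_neg hs]
    congr 1; apply eS.injective; rw [Equiv.apply_symm_apply]
  have hle' : ∀ i, lvf i ≤ top' := by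
    intro i; rw [hlvf]; simp only []; split_ifs with hi
    · exact le_rfl
    · exact (hlvS'lt _).le
  have hlvflt : ∀ i, lvf i < top' ↔ lv i < top := by
    intro i
    rw [← not_iff_not, not_lt, not_lt]
    constructor
    · intro h; have := (hlvfT i).mp (le_antisymm (hle' i) h); exact this.ge
    · intro h; rw [(hlvfT i).mpr (le_antisymm (hle i) h)]
  set e' : Fin nS ≃ {i : Fin n // lvf i < top'} :=
    eS.trans (Equiv.subtypeEquivRight fun i => (hlvflt i).symm) with he'
  have he'val : ∀ s, ((e' s : {i : Fin n // lvf i < top'}) : Fin n) = (eS s : Fin n) := fun s => rfl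
  -- extension by zero from the lower indices
  have hextS_prod : ∀ {N : Type} [CommGroupWithZero N] (f : Fin n → N) (ms : Fin nS → ℤ),
      (∏ j, f j ^ ((fun j => if hj : lv j = top then 0 else ms (eS.symm ⟨j, (lt_of_le_of_ne (hle j) hj)⟩)) j)) =
        ∏ s, f (eS s) ^ (ms s) := by
    intro N _ f ms
    rw [hsplit _ (fun j => f j ^ ((fun j => if hj : lv j = top then 0 else ms (eS.symm ⟨j, (lt_of_le_of_ne (hle j) hj)⟩)) j))]
    have h1 : (∏ t, f (eT t) ^ ((fun j => if hj : lv j = top then (0 : ℤ) else ms (eS.symm ⟨j, (lt_of_le_of_ne (hle j) hj)⟩)) (eT t))) = 1 :=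
      Finset.prod_eq_one fun t _ => by simp only []; rw [dif_pos (eT t).2, zpow_zero]
    rw [h1, one_mul]
    refine Finset.prod_congr rfl fun s _ => ?_
    have hs : ¬ lv ((eS s : {i : Fin n // lv i < top}) : Fin n) = top := (eS s).2.ne
    simp only []; rw [dif_neg hs]
    congr 2; apply eS.injective; rw [Equiv.apply_symm_apply]
  -- products over the final parameters, split
  have hxf_prod : ∀ {N : Type} [CommMonoid N] (φ : K → N) (m : Fin n → ℤ) (pw : N → ℤ → N),
      (∏ j, pw (φ (xf j)) (m j)) = (∏ t, pw (φ (z t)) (m (eT t))) * ∏ s, pw (φ (u s)) (m (eS s)) := by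
    intro N _ φ m pw
    rw [hsplit _ (fun j => pw (φ (xf j)) (m j))]
    congr 1
    · exact Finset.prod_congr rfl fun t _ => by rw [hxfT]
    · exact Finset.prod_congr rfl fun s _ => by rw [hxfS]
  -- `W` is cut out by the lower monomials of the final system as well
  have hWmem' : ∀ w : K, w ∈ W ↔ ∃ m : Fin n → ℤ, (∀ j, top' ≤ lvf j → m j = 0) ∧
      O.valuation w ≤ ∏ j, O.valuation (xf j) ^ (m j) := by
    intro w
    rw [hWmem]
    constructor
    · rintro ⟨m, hm, hle1⟩
      -- `x^m = u^(m D')`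
      set ms : Fin nS → ℤ := fun s => ∑ s1, m (eS s1) * (D' s1 s : ℤ) with hms
      refine ⟨fun j => if hj : lv j = top then 0 else ms (eS.symm ⟨j, (lt_of_le_of_ne (hle j) hj)⟩), ?_, ?_⟩
      · intro j hj
        have hj' : lv j = top := (hlvfT j).mp (le_antisymm (hle' j) hj)
        simp only []; rw [dif_pos hj']
      · rw [hextS_prod (fun j => O.valuation (xf j)) ms]
        simp_rw [hxfS]
        have h1 : (∏ j, O.valuation (x j) ^ (m j)) = ∏ s, O.valuation (u s) ^ (ms s) := by
          rw [hsplit _ (fun j => O.valuation (x j) ^ (m j))]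
          have hTp : (∏ t, O.valuation (x (eT t)) ^ (m (eT t))) = 1 :=
            Finset.prod_eq_one fun t _ => by rw [hm _ (eT t).2.ge, zpow_zero]
          rw [hTp, one_mul, ← hmonO]
          simp_rw [hxu]
          rw [ap_prod_zpow_matrix u hu0 (fun s1 s => (D' s1 s : ℤ)) (fun s1 => m (eS s1)), map_prod]
          exact Finset.prod_congr rfl fun s _ => by rw [map_zpow₀]
        rw [← h1]; exact hle1
    · rintro ⟨m, hm, hle1⟩
      have hmT : ∀ t, m (eT t) = 0 := fun t => hm _ (by rw [(hlvfT _).mpr (eT t).2])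
      -- `u^(m_S) = x^(m_S C')`
      set mx : Fin nS → ℤ := fun s1 => ∑ s, m (eS s) * C' s s1 with hmx
      refine ⟨fun j => if hj : lv j = top then 0 else mx (eS.symm ⟨j, (lt_of_le_of_ne (hle j) hj)⟩), ?_, ?_⟩
      · intro j hj
        have hj' : lv j = top := le_antisymm (hle j) hj
        simp only []; rw [dif_pos hj']
      · rw [hextS_prod (fun j => O.valuation (x j)) mx]
        have h1 : (∏ j, O.valuation (xf j) ^ (m j)) = ∏ s1, O.valuation (x (eS s1)) ^ (mx s1) := by
          rw [hxf_prod (fun w => O.valuation w) m (fun a b => a ^ b)]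
          have hTp : (∏ t, O.valuation (z t) ^ (m (eT t))) = 1 :=
            Finset.prod_eq_one fun t _ => by rw [hmT t, zpow_zero]
          rw [hTp, one_mul]
          have h2 : (∏ s, O.valuation (u s) ^ (m (eS s))) = O.valuation (∏ s, u s ^ (m (eS s))) := by
            rw [map_prod]; exact Finset.prod_congr rfl fun s _ => (map_zpow₀ _ _ _).symm
          rw [h2, hu]
          simp only []
          rw [ap_prod_zpow_matrix _ (fun s1 => hx0 _) C' (fun s => m (eS s)), map_prod]
          exact Finset.prod_congr rfl fun s1 _ => by rw [map_zpow₀]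
        rw [← h1]; exact hle1
  -- finiteness, top span, top independence, lower smallness of the final system
  have hR₃FG : R₃.FG := by
    obtain ⟨sB, hsB⟩ := hBFG
    refine ⟨sB ∪ Finset.univ.image z, ?_⟩
    rw [Finset.coe_union, Finset.coe_image, Finset.coe_univ, Set.image_univ, Algebra.adjoin_union, hsB, hR₃,
      Algebra.adjoin_union, Algebra.adjoin_eq]
  have hT' : ∃ i, lvf i = top' := ⟨i₀, (hlvfT i₀).mpr hi₀⟩
  have hWspan' : Ideal.span (Set.range fun i : {i : Fin n // lvf i = top'} => (⟨xf i.1, hxfR₃ i.1⟩ : R₃.toSubring)) =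
      Ideal.comap (Subring.inclusion hR₃W) (maximalIdeal W) := by
    rw [← hspan₃]
    congr 1
    ext w; constructor
    · rintro ⟨i, rfl⟩
      have hi : lv i.1 = top := (hlvfT _).mp i.2
      refine ⟨eT.symm ⟨i.1, hi⟩, Subtype.ext ?_⟩
      change z (eT.symm ⟨i.1, hi⟩) = xf i.1
      rw [hxf]; simp only []; rw [dif_pos hi]
    · rintro ⟨t, rfl⟩
      refine ⟨⟨(eT t : Fin n), (hlvfT _).mpr (eT t).2⟩, Subtype.ext ?_⟩
      change xf (eT t) = z t
      exact hxfT t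
  have hWind' : ∀ μ : Fin n → ℤ, (∀ j, lvf j ≠ top' → μ j = 0) →
      W.valuation (∏ j, xf j ^ (μ j)) = 1 → μ = 0 := by
    intro μ hμ h1
    have hμS : ∀ s, μ (eS s) = 0 := fun s => hμ _ (by rw [Ne, hlvfT]; exact (eS s).2.ne)
    have h2 : W.valuation (∏ j, xf j ^ (μ j)) = ∏ t, W.valuation (xT t) ^ (μ (eT t)) := by
      have h21 : W.valuation (∏ j, xf j ^ (μ j)) = ∏ j, W.valuation (xf j) ^ (μ j) := by
        rw [map_prod]; exact Finset.prod_congr rfl fun j _ => map_zpow₀ _ _ _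
      rw [h21, hxf_prod (fun w => W.valuation w) μ (fun a b => a ^ b)]
      have hSp : (∏ s, W.valuation (u s) ^ (μ (eS s))) = 1 :=
        Finset.prod_eq_one fun s _ => by rw [hμS s, zpow_zero]
      rw [hSp, mul_one]
      exact Finset.prod_congr rfl fun t _ => by rw [hzW1]
    rw [h2] at h1
    have h3 := hind₁ (fun t => μ (eT t)) h1
    funext j
    by_cases hj : lv j = top
    · have : j = (eT (eT.symm ⟨j, hj⟩) : Fin n) := by rw [Equiv.apply_symm_apply]
      rw [this]; exact congrFun h3 (eT.symm ⟨j, hj⟩)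
    · exact hμ j (by rw [Ne, hlvfT]; exact hj)
  have hySv' : ∀ i, lvf i < top' → O.valuation (xf i) < 1 := by
    intro i hi
    have hi' : lv i < top := (hlvflt i).mp hi
    have : xf i = u (eS.symm ⟨i, hi'⟩) := by
      have := hxfS (eS.symm ⟨i, hi'⟩)
      rw [Equiv.apply_symm_apply] at this
      exact this
    rw [this]; exact huv _
  -- the residual data
  have hlvf_e : (fun j => lvf (e' j).1) = lvS' := funext fun s => by rw [he'val, hlvfS]
  have hres' : ∃ (Rb'' : Subalgebra k (ResidueField W))
      (hRb'' : Rb''.toSubring ≤ Ob.toSubring)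
      (xb'' : Fin nS → ResidueField W) (hxb'' : ∀ j, xb'' j ∈ Rb''),
      (∀ j, residue W ⟨xf (e' j).1, hOW (hR₃O (hxfR₃ (e' j).1))⟩ = xb'' j) ∧
      (∀ (r : K) (hr : r ∈ R₃), residue W ⟨r, hOW (hR₃O hr)⟩ ∈ Rb'') ∧
      (∀ rb ∈ Rb'', ∃ (r : K) (hr : r ∈ R₃), residue W ⟨r, hOW (hR₃O hr)⟩ = rb) ∧
      FlagAdaptedChart Ob Rb'' hRb'' xb'' hxb'' (fun j => lvf (e' j).1) := by
    refine ⟨Rb', hRb'O, xb', hxb', fun s => ?_, hπR₃, hsurj₃, hlvf_e ▸ hbflag'⟩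
    rw [← huπ s]
    congr 1
    apply Subtype.ext
    change xf (e' s).1 = u s
    rw [he'val, hxfS]
  have hflag₃ : FlagAdaptedChart O R₃ hR₃O xf hxfR₃ lvf :=
    ap_flagAdaptedChart_of_residual O hk R₃ hR₃O xf hxfR₃ lvf top' hle' hT' W hOW hWmem' hWr1 hR₃FG hxf0
      hWspan' hWind' hySv' nS e' hres'
  -- products over the final system with exponent vectors assembled from top / lower parts
  have hEXTN : ∀ (bT : Fin nT → ℕ) (bS : Fin nS → ℕ),
      (∏ j, xf j ^ ((fun j => if hj : lv j = top then bT (eT.symm ⟨j, hj⟩) else bS (eS.symm ⟨j, (lt_of_le_of_ne (hle j) hj)⟩)) j)) =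
        (∏ t, z t ^ (bT t)) * ∏ s, u s ^ (bS s) := by
    intro bT bS
    rw [hsplit _ (fun j => xf j ^ ((fun j => if hj : lv j = top then bT (eT.symm ⟨j, hj⟩) else bS (eS.symm ⟨j, (lt_of_le_of_ne (hle j) hj)⟩)) j))]
    congr 1
    · refine Finset.prod_congr rfl fun t _ => ?_
      have ht : lv ((eT t : {i : Fin n // lv i = top}) : Fin n) = top := (eT t).2
      simp only []; rw [dif_pos ht, hxfT]
      congr 2; apply eT.injective; rw [Equiv.apply_symm_apply]
    · refine Finset.prod_congr rfl fun s _ => ?_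
      have hs : ¬ lv ((eS s : {i : Fin n // lv i < top}) : Fin n) = top := (eS s).2.ne
      simp only []; rw [dif_neg hs, hxfS]
      congr 2; apply eS.injective; rw [Equiv.apply_symm_apply]
  have hEXTZx : ∀ (cT : Fin nT → ℤ) (cS : Fin nS → ℤ),
      (∏ j, x j ^ ((fun j => if hj : lv j = top then cT (eT.symm ⟨j, hj⟩) else cS (eS.symm ⟨j, (lt_of_le_of_ne (hle j) hj)⟩)) j)) =
        (∏ t, x (eT t) ^ (cT t)) * ∏ s, x (eS s) ^ (cS s) := by
    intro cT cS
    rw [hsplit _ (fun j => x j ^ ((fun j => if hj : lv j = top then cT (eT.symm ⟨j, hj⟩) else cS (eS.symm ⟨j, (lt_of_le_of_ne (hle j) hj)⟩)) j))]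
    congr 1
    · refine Finset.prod_congr rfl fun t _ => ?_
      have ht : lv ((eT t : {i : Fin n // lv i = top}) : Fin n) = top := (eT t).2
      simp only []; rw [dif_pos ht]
      congr 2; apply eT.injective; rw [Equiv.apply_symm_apply]
    · refine Finset.prod_congr rfl fun s _ => ?_
      have hs : ¬ lv ((eS s : {i : Fin n // lv i < top}) : Fin n) = top := (eS s).2.ne
      simp only []; rw [dif_neg hs]
      congr 2; apply eS.injective; rw [Equiv.apply_symm_apply]
  -- `u`-monomials are `x_S`-monomials
  have humon : ∀ (b : Fin nS → ℤ), (∏ s, u s ^ (b s)) = ∏ s1, x (eS s1) ^ (∑ s, b s * C' s s1) := by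
    intro b; rw [hu]; exact ap_prod_zpow_matrix _ (fun s1 => hx0 _) C' b
  have hxvS : ∀ (ms : Fin nS → ℤ),
      (∏ j, O.valuation (xf j) ^ ((fun j => if hj : lv j = top then 0 else ms (eS.symm ⟨j, lt_of_le_of_ne (hle j) hj⟩)) j)) =
        ∏ s, O.valuation (u s) ^ (ms s) := by
    intro ms
    have h1 := hextS_prod (fun j => O.valuation (xf j)) ms
    simp_rw [hxfS] at h1
    exact h1
  exact ⟨xf, hxfR₃, lvf, hxf, hxfT, hxfS, hxf0, hflag₃, hEXTN, hEXTZx, hxvS⟩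

end Summit.ResolutionOfSingularities.ResolutionOfSingularities.Theorems.PfaffLine
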